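import Mathlib
import HarnessLib
import Summits.ValiantsHypothesis.ValiantsHypothesis.Theorems.LacunarySymmetroidMatrixDescartesProductPlusOneSixthOrderRowLaws
import Summits.ValiantsHypothesis.ValiantsHypothesis.Theorems.LacunarySymmetroidMatrixDescartesProductPlusOneSixthOrderShell
import Summits.ValiantsHypothesis.ValiantsHypothesis.Theorems.LacunarySymmetroidMatrixDescartesProductPlusOneSlowKneeCellRateFree

/-!
# LINE (A) `product_plus_one` (crux `MatrixDescartes`, stmt-ValiantsHypothesis-18050, V1) — W-CB, brick E3a of the ORDER-6 ADDITIVE CERTIFICATE: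
# the ROW TOWER `S₀…S₆` of a binomial company (derivatives of the `ψ₁,ψ₂`-polynomials) and the PER-ROW FACTS on a window

`K = 3`, support `d 0 < d 1 < d 2` with gap letters `d 1 = d 0 + e₁ + 1`, `d 2 = d 1 + e₂ + 1` and the RATIO HYPOTHESIS `2(d1 − d0) ≤ d2 − d1`
(`2p ≤ s`, `p = e₁+1`, `s = e₂+1`, `q = p+s`; the floor's open core is `(d2−d0)/(d1−d0) > 4`, inside).  Window `(u,v)`, `0 < u`.  Every row
`f_j = Σ_l C (a j l) X^{d l}` is a BINOMIAL of the menu (tower of ✓ `…CloudDefs`, `ψ₁ʲ(x) = rowPsi1 e₁ e₂ (a j 0) (−a j 1) (−a j 2) x`):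
 (K01) slow knee `a j 2 = 0 ∧ 0 < a j 0·a j 1` — NO condition;  (P01) slow pole `a j 2 = 0 ∧ a j 0·a j 1 < 0 ∧ 0 ≤ f_j(u)f_j(v)`;
 (K12) middle-rate knee `a j 0 = 0 ∧ 0 < a j 1·a j 2` whose RING MISSES THE WINDOW: `∀ x ∈ (u,v), 0 < c₀(s) + c₁(s)·ψ₁ʲ(x) + 5040·ψ₁ʲ(x)²`;
 (P12) pole `a j 0 = 0 ∧ a j 1·a j 2 < 0 ∧ 0 ≤ f_j(u)f_j(v)`;  (K02) fast knee `a j 1 = 0 ∧ 0 < a j 0·a j 2` whose ring misses the window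
 (`0 < c₀(q) + c₁(q)·ψ₁ʲ(x) + 5040·ψ₁ʲ(x)²` on `(u,v)`);  (P02) pole `a j 1 = 0 ∧ a j 0·a j 2 < 0 ∧ 0 ≤ f_j(u)f_j(v)`;
(coefficients ✓/⧗ E1 `…SixthOrderRowLaws`).  THIS FILE (E3a): the row-level calculus the cell needs —
* `hasDerivAt_tower2/3/4/5` — θ-derivatives of the row polynomials `r²ψ₁ + 6ψ₁²`, `(r² + 12ψ₁)ψ₂`, `r⁴ψ₁ + 30r²ψ₁² + 120ψ₁³`, `(r⁴ + 60r²ψ₁ + 360ψ₁²)ψ₂`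
  (values `(r²+12ψ₁)ψ₂`, `r⁴ψ₁ + 30r²ψ₁² + 120ψ₁³`, `(r⁴+60r²ψ₁+360ψ₁²)ψ₂`, `r⁶ψ₁ + 126r⁴ψ₁² + 1680r²ψ₁³ + 5040ψ₁⁴`, from ✓ `hasDerivAt_rowPsi1/2` and the
  closure laws `ψ₂² = r²ψ₁² + 4ψ₁³`, `ψ₃ = r²ψ₁ + 6ψ₁²` AT THE POINT);
* `sixthOrder_row_value` — the order-6 row value `S₆ − e₁S₄ + e₂S₂ − e₃S₀` equals `Q_r(ψ₁) = 6(21r⁴ − 5e₁r² + e₂)ψ₁² + 120(14r² − e₁)ψ₁³ + 5040ψ₁⁴` when `r`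
  is one of the three rates (the linear term dies, ✓/⧗ `sixthOrder_lin_vanish`);
* ★ `sixthOrder_row_facts` — for ONE menu row: a rate `r ∈ {p, s, p+s}` with, at every point of the window, the normal form nonzero, both closure laws,
  and `Q_r(ψ₁) > 0` (poles / slow knee: E1 sign theorems; middle / fast knee: the ring hypothesis).
The cell itself (no seven roots / at most six) is E3b `…SixthOrderCell`.

HONEST FRAMING: calculus + algebra for one W-cell; proves nothing about `WronskianBudgetK3` / `OneChangeFloorK3` / the stubs / 18050 / `MatrixDescartes` / B;
`VP ≠ VNP` is NOT proved.  No definitions, no named facts, no sorry; Mathlib + ✓ lane modules only.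
-/

set_option linter.dupNamespace false

namespace Summit.ValiantsHypothesis.ValiantsHypothesis.Theorems.LacunarySymmetroidMatrixDescartes

namespace ProductPlusOne

open Finset Set Polynomial
open scoped BigOperators Topology Polynomial

/-! ### §1 The row tower: derivatives of the `ψ₁,ψ₂`-polynomials -/

section Row

variable (e₁ e₂ : ℕ) (A B C : ℝ)

/-- `θ(r²ψ₁ + 6ψ₁²) = (r² + 12ψ₁)ψ₂`. [this file's lemma] -/
theorem hasDerivAt_tower2 (r : ℝ) {x : ℝ} (hx : x ≠ 0) (hF : A - B * x ^ (e₁ + 1) - C * x ^ (e₁ + e₂ + 2) ≠ 0) :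
    HasDerivAt (fun t => r ^ 2 * rowPsi1 e₁ e₂ A B C t + 6 * rowPsi1 e₁ e₂ A B C t ^ 2)
      (((r ^ 2 + 12 * rowPsi1 e₁ e₂ A B C x) * rowPsi2 e₁ e₂ A B C x) / x) x := by
  have h1 := hasDerivAt_rowPsi1 e₁ e₂ A B C hx hF
  have h := (h1.const_mul (r ^ 2)).add ((h1.pow 2).const_mul 6)
  refine h.congr_deriv ?_
  simp only [Nat.cast_ofNat]
  field_simp
  ring

/-- `θ((r² + 12ψ₁)ψ₂) = r⁴ψ₁ + 30r²ψ₁² + 120ψ₁³` given the closure laws at `x`. [this file's lemma] -/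
theorem hasDerivAt_tower3 (r : ℝ) {x : ℝ} (hx : x ≠ 0) (hF : A - B * x ^ (e₁ + 1) - C * x ^ (e₁ + e₂ + 2) ≠ 0)
    (h2 : rowPsi2 e₁ e₂ A B C x ^ 2 = r ^ 2 * rowPsi1 e₁ e₂ A B C x ^ 2 + 4 * rowPsi1 e₁ e₂ A B C x ^ 3)
    (h3 : rowPsi3 e₁ e₂ A B C x = r ^ 2 * rowPsi1 e₁ e₂ A B C x + 6 * rowPsi1 e₁ e₂ A B C x ^ 2) :
    HasDerivAt (fun t => (r ^ 2 + 12 * rowPsi1 e₁ e₂ A B C t) * rowPsi2 e₁ e₂ A B C t)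
      ((r ^ 4 * rowPsi1 e₁ e₂ A B C x + 30 * r ^ 2 * rowPsi1 e₁ e₂ A B C x ^ 2 + 120 * rowPsi1 e₁ e₂ A B C x ^ 3) / x) x := by
  have h1 := hasDerivAt_rowPsi1 e₁ e₂ A B C hx hF
  have h2' := hasDerivAt_rowPsi2 e₁ e₂ A B C hx hF
  have h := (((h1.const_mul 12).const_add (r ^ 2))).mul h2'
  refine h.congr_deriv ?_
  field_simp
  have key := ladder_sq h2 h3
  nlinarith [key, h2, h3]

/-- `θ(r⁴ψ₁ + 30r²ψ₁² + 120ψ₁³) = (r⁴ + 60r²ψ₁ + 360ψ₁²)ψ₂`. [this file's lemma] -/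
theorem hasDerivAt_tower4 (r : ℝ) {x : ℝ} (hx : x ≠ 0) (hF : A - B * x ^ (e₁ + 1) - C * x ^ (e₁ + e₂ + 2) ≠ 0) :
    HasDerivAt (fun t => r ^ 4 * rowPsi1 e₁ e₂ A B C t + 30 * r ^ 2 * rowPsi1 e₁ e₂ A B C t ^ 2 + 120 * rowPsi1 e₁ e₂ A B C t ^ 3)
      (((r ^ 4 + 60 * r ^ 2 * rowPsi1 e₁ e₂ A B C x + 360 * rowPsi1 e₁ e₂ A B C x ^ 2) * rowPsi2 e₁ e₂ A B C x) / x) x := by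
  have h1 := hasDerivAt_rowPsi1 e₁ e₂ A B C hx hF
  have h := ((h1.const_mul (r ^ 4)).add ((h1.pow 2).const_mul (30 * r ^ 2))).add ((h1.pow 3).const_mul 120)
  refine h.congr_deriv ?_
  simp only [Nat.cast_ofNat]
  field_simp
  ring

/-- `θ((r⁴ + 60r²ψ₁ + 360ψ₁²)ψ₂) = r⁶ψ₁ + 126r⁴ψ₁² + 1680r²ψ₁³ + 5040ψ₁⁴` given the closure laws at `x`. [this file's lemma] -/
theorem hasDerivAt_tower5 (r : ℝ) {x : ℝ} (hx : x ≠ 0) (hF : A - B * x ^ (e₁ + 1) - C * x ^ (e₁ + e₂ + 2) ≠ 0)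
    (h2 : rowPsi2 e₁ e₂ A B C x ^ 2 = r ^ 2 * rowPsi1 e₁ e₂ A B C x ^ 2 + 4 * rowPsi1 e₁ e₂ A B C x ^ 3)
    (h3 : rowPsi3 e₁ e₂ A B C x = r ^ 2 * rowPsi1 e₁ e₂ A B C x + 6 * rowPsi1 e₁ e₂ A B C x ^ 2) :
    HasDerivAt (fun t => (r ^ 4 + 60 * r ^ 2 * rowPsi1 e₁ e₂ A B C t + 360 * rowPsi1 e₁ e₂ A B C t ^ 2) * rowPsi2 e₁ e₂ A B C t)
      ((r ^ 6 * rowPsi1 e₁ e₂ A B C x + 126 * r ^ 4 * rowPsi1 e₁ e₂ A B C x ^ 2 + 1680 * r ^ 2 * rowPsi1 e₁ e₂ A B C x ^ 3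
        + 5040 * rowPsi1 e₁ e₂ A B C x ^ 4) / x) x := by
  have h1 := hasDerivAt_rowPsi1 e₁ e₂ A B C hx hF
  have h2' := hasDerivAt_rowPsi2 e₁ e₂ A B C hx hF
  have hpoly : HasDerivAt (fun t => r ^ 4 + 60 * r ^ 2 * rowPsi1 e₁ e₂ A B C t + 360 * rowPsi1 e₁ e₂ A B C t ^ 2)
      (60 * r ^ 2 * (rowPsi2 e₁ e₂ A B C x / x) + 360 * (2 * rowPsi1 e₁ e₂ A B C x ^ 1 * (rowPsi2 e₁ e₂ A B C x / x))) x := by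
    have h := ((h1.const_mul (60 * r ^ 2)).const_add (r ^ 4)).add ((h1.pow 2).const_mul 360)
    refine h.congr_deriv ?_
    simp only [Nat.cast_ofNat]
  have h := hpoly.mul h2'
  refine h.congr_deriv ?_
  have hnum : (60 * r ^ 2 + 720 * rowPsi1 e₁ e₂ A B C x) * rowPsi2 e₁ e₂ A B C x ^ 2
      + (r ^ 4 + 60 * r ^ 2 * rowPsi1 e₁ e₂ A B C x + 360 * rowPsi1 e₁ e₂ A B C x ^ 2) * rowPsi3 e₁ e₂ A B C x
      = r ^ 6 * rowPsi1 e₁ e₂ A B C x + 126 * r ^ 4 * rowPsi1 e₁ e₂ A B C x ^ 2 + 1680 * r ^ 2 * rowPsi1 e₁ e₂ A B C x ^ 3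
        + 5040 * rowPsi1 e₁ e₂ A B C x ^ 4 := by
    linear_combination (60 * r ^ 2 + 720 * rowPsi1 e₁ e₂ A B C x) * h2
      + (r ^ 4 + 60 * r ^ 2 * rowPsi1 e₁ e₂ A B C x + 360 * rowPsi1 e₁ e₂ A B C x ^ 2) * h3
  rw [← hnum]
  field_simp
  ring

end Row

/-! ### §2 Per-row facts on the window -/

/-- The generic sixth-order image `Q_r(ψ) = 6(21r⁴ − 5e₁r² + e₂)ψ² + 120(14r² − e₁)ψ³ + 5040ψ⁴` with `e₁ = p²+s²+(p+s)²`,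
`e₂ = p²s² + p²(p+s)² + s²(p+s)²` — written out (no definition); this lemma packages «the linear term vanishes at the three rates» as the
identity between the order-6 row value `S₆ − e₁S₄ + e₂S₂ − e₃S₀` and `Q_r(ψ₁)`. [this file's lemma] -/
theorem sixthOrder_row_value (p s r ψ : ℝ) (hr : r = p ∨ r = s ∨ r = p + s) :
    (r ^ 6 * ψ + 126 * r ^ 4 * ψ ^ 2 + 1680 * r ^ 2 * ψ ^ 3 + 5040 * ψ ^ 4)
      - (p ^ 2 + s ^ 2 + (p + s) ^ 2) * (r ^ 4 * ψ + 30 * r ^ 2 * ψ ^ 2 + 120 * ψ ^ 3)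
      + (p ^ 2 * s ^ 2 + p ^ 2 * (p + s) ^ 2 + s ^ 2 * (p + s) ^ 2) * (r ^ 2 * ψ + 6 * ψ ^ 2)
      - p ^ 2 * s ^ 2 * (p + s) ^ 2 * ψ
    = 6 * (21 * r ^ 4 - 5 * (p ^ 2 + s ^ 2 + (p + s) ^ 2) * r ^ 2 + (p ^ 2 * s ^ 2 + p ^ 2 * (p + s) ^ 2 + s ^ 2 * (p + s) ^ 2)) * ψ ^ 2
      + 120 * (14 * r ^ 2 - (p ^ 2 + s ^ 2 + (p + s) ^ 2)) * ψ ^ 3 + 5040 * ψ ^ 4 := by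
  have hlin := sixthOrder_lin_vanish p s r hr
  have : (r ^ 6 - (p ^ 2 + s ^ 2 + (p + s) ^ 2) * r ^ 4 + (p ^ 2 * s ^ 2 + p ^ 2 * (p + s) ^ 2 + s ^ 2 * (p + s) ^ 2) * r ^ 2
      - p ^ 2 * s ^ 2 * (p + s) ^ 2) = (r ^ 2 - p ^ 2) * (r ^ 2 - s ^ 2) * (r ^ 2 - (p + s) ^ 2) := by ring
  linear_combination ψ * this + ψ * hlin

/-- **Per-row facts on the window** (one binomial row `b` of the menu): a rate `r ∈ {p, s, p+s}` such that, at every point of the window, the normal form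
does not vanish, the two closure laws hold with rate `r`, and the order-6 image `Q_r(ψ₁)` is POSITIVE (poles and slow knees by E1's sign theorems, middle/fast
knees by the ring hypothesis). [this file's lemma] -/
theorem sixthOrder_row_facts (e₁ e₂ : ℕ) (h2p : 2 * (e₁ + 1) ≤ e₂ + 1) (b : Fin 3 → ℝ) {u v : ℝ} (hu : 0 < u)
    (hrow :
      (b 2 = 0 ∧ 0 < b 0 * b 1) ∨
      (b 2 = 0 ∧ b 0 * b 1 < 0 ∧ 0 ≤ (b 0 + b 1 * u ^ (e₁ + 1) + b 2 * u ^ (e₁ + e₂ + 2)) * (b 0 + b 1 * v ^ (e₁ + 1) + b 2 * v ^ (e₁ + e₂ + 2))) ∨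
      (b 0 = 0 ∧ 0 < b 1 * b 2 ∧ ∀ x ∈ Ioo u v,
          0 < 6 * ((((e₂ : ℝ) + 1) - ((e₁ : ℝ) + 1)) * (2 * ((e₂ : ℝ) + 1) - ((e₁ : ℝ) + 1)) * (2 * ((e₂ : ℝ) + 1) + ((e₁ : ℝ) + 1))
                * (3 * ((e₂ : ℝ) + 1) + ((e₁ : ℝ) + 1)))
            + 240 * ((3 * ((e₂ : ℝ) + 1) + ((e₁ : ℝ) + 1)) * (2 * ((e₂ : ℝ) + 1) - ((e₁ : ℝ) + 1))) * rowPsi1 e₁ e₂ (b 0) (-(b 1)) (-(b 2)) x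
            + 5040 * rowPsi1 e₁ e₂ (b 0) (-(b 1)) (-(b 2)) x ^ 2) ∨
      (b 0 = 0 ∧ b 1 * b 2 < 0 ∧ 0 ≤ (b 0 + b 1 * u ^ (e₁ + 1) + b 2 * u ^ (e₁ + e₂ + 2)) * (b 0 + b 1 * v ^ (e₁ + 1) + b 2 * v ^ (e₁ + e₂ + 2))) ∨
      (b 1 = 0 ∧ 0 < b 0 * b 2 ∧ ∀ x ∈ Ioo u v,
          0 < 6 * (12 * ((e₁ : ℝ) + 1) ^ 4 + 56 * ((e₁ : ℝ) + 1) ^ 3 * ((e₂ : ℝ) + 1) + 89 * ((e₁ : ℝ) + 1) ^ 2 * ((e₂ : ℝ) + 1) ^ 2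
                + 56 * ((e₁ : ℝ) + 1) * ((e₂ : ℝ) + 1) ^ 3 + 12 * ((e₂ : ℝ) + 1) ^ 4)
            + 120 * (12 * ((e₁ : ℝ) + 1) ^ 2 + 26 * ((e₁ : ℝ) + 1) * ((e₂ : ℝ) + 1) + 12 * ((e₂ : ℝ) + 1) ^ 2) * rowPsi1 e₁ e₂ (b 0) (-(b 1)) (-(b 2)) x
            + 5040 * rowPsi1 e₁ e₂ (b 0) (-(b 1)) (-(b 2)) x ^ 2) ∨
      (b 1 = 0 ∧ b 0 * b 2 < 0 ∧ 0 ≤ (b 0 + b 1 * u ^ (e₁ + 1) + b 2 * u ^ (e₁ + e₂ + 2)) * (b 0 + b 1 * v ^ (e₁ + 1) + b 2 * v ^ (e₁ + e₂ + 2)))) :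
    ∃ r : ℝ, (r = ((e₁ : ℝ) + 1) ∨ r = ((e₂ : ℝ) + 1) ∨ r = ((e₁ : ℝ) + 1) + ((e₂ : ℝ) + 1)) ∧ ∀ x ∈ Ioo u v,
      b 0 - (-(b 1)) * x ^ (e₁ + 1) - (-(b 2)) * x ^ (e₁ + e₂ + 2) ≠ 0 ∧
      rowPsi3 e₁ e₂ (b 0) (-(b 1)) (-(b 2)) x
        = r ^ 2 * rowPsi1 e₁ e₂ (b 0) (-(b 1)) (-(b 2)) x + 6 * rowPsi1 e₁ e₂ (b 0) (-(b 1)) (-(b 2)) x ^ 2 ∧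
      rowPsi2 e₁ e₂ (b 0) (-(b 1)) (-(b 2)) x ^ 2
        = r ^ 2 * rowPsi1 e₁ e₂ (b 0) (-(b 1)) (-(b 2)) x ^ 2 + 4 * rowPsi1 e₁ e₂ (b 0) (-(b 1)) (-(b 2)) x ^ 3 ∧
      0 < 6 * (21 * r ^ 4 - 5 * (((e₁ : ℝ) + 1) ^ 2 + ((e₂ : ℝ) + 1) ^ 2 + (((e₁ : ℝ) + 1) + ((e₂ : ℝ) + 1)) ^ 2) * r ^ 2
              + (((e₁ : ℝ) + 1) ^ 2 * ((e₂ : ℝ) + 1) ^ 2 + ((e₁ : ℝ) + 1) ^ 2 * (((e₁ : ℝ) + 1) + ((e₂ : ℝ) + 1)) ^ 2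
                + ((e₂ : ℝ) + 1) ^ 2 * (((e₁ : ℝ) + 1) + ((e₂ : ℝ) + 1)) ^ 2)) * rowPsi1 e₁ e₂ (b 0) (-(b 1)) (-(b 2)) x ^ 2
          + 120 * (14 * r ^ 2 - (((e₁ : ℝ) + 1) ^ 2 + ((e₂ : ℝ) + 1) ^ 2 + (((e₁ : ℝ) + 1) + ((e₂ : ℝ) + 1)) ^ 2))
              * rowPsi1 e₁ e₂ (b 0) (-(b 1)) (-(b 2)) x ^ 3
          + 5040 * rowPsi1 e₁ e₂ (b 0) (-(b 1)) (-(b 2)) x ^ 4 := by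
  set p : ℝ := (e₁ : ℝ) + 1 with hp
  set s : ℝ := (e₂ : ℝ) + 1 with hs
  have hp0 : 0 < p := by rw [hp]; positivity
  have hs0 : 0 < s := by rw [hs]; positivity
  have h2ps : 2 * p ≤ s := by
    rw [hp, hs]
    have : ((2 * (e₁ + 1) : ℕ) : ℝ) ≤ ((e₂ + 1 : ℕ) : ℝ) := by exact_mod_cast h2p
    push_cast at this
    linarith
  have hps : p ≤ s := by linarith
  have hps' : p < s := by linarith
  have huv_pos : ∀ x ∈ Ioo u v, 0 < x := fun x hx => hu.trans hx.1
  rcases hrow with ⟨h2, hsgn⟩ | ⟨h2, hsgn, hend⟩ | ⟨h0, hsgn, hring⟩ | ⟨h0, hsgn, hend⟩ | ⟨h1, hsgn, hring⟩ | ⟨h1, hsgn, hend⟩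
  · -- (K01) slow knee, rate p
    refine ⟨p, Or.inl rfl, fun x hx => ?_⟩
    have hx0 := huv_pos x hx
    have hn2 : -(b 2) = 0 := by rw [h2, neg_zero]
    have hAB : b 0 * (-(b 1)) < 0 := by nlinarith
    have hψ := pair01_knee_rowPsi1_neg e₁ e₂ (b 0) (-(b 1)) hx0 hAB
    have hF : b 0 - (-(b 1)) * x ^ (e₁ + 1) ≠ 0 := by
      intro h
      have hA : b 0 = -(b 1) * x ^ (e₁ + 1) := by linarith
      rw [hA] at hAB
      nlinarith [sq_nonneg (b 1), pow_pos hx0 (e₁ + 1)]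
    rw [hn2]
    refine ⟨by rwa [zero_mul, sub_zero], ?_, ?_, ?_⟩
    · have h := pair01_rowPsi3_law e₁ e₂ (b 0) (-(b 1)) x
      rw [hp]; linarith [h]
    · rw [hp]; exact pair01_rowPsi2_sq e₁ e₂ (b 0) (-(b 1)) x
    · rw [sixthOrder_c0_slow p s, sixthOrder_c1_slow p s]
      exact sixthOrder_knee_slow_pos hp0 h2ps hψ
  · -- (P01) slow pole, rate p
    refine ⟨p, Or.inl rfl, fun x hx => ?_⟩
    have hx0 := huv_pos x hx
    have hn2 : -(b 2) = 0 := by rw [h2, neg_zero]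
    have hb1 : b 1 ≠ 0 := by rintro h; rw [h, mul_zero] at hsgn; exact lt_irrefl _ hsgn
    have hend' : 0 ≤ (b 0 + b 1 * u ^ (e₁ + 1)) * (b 0 + b 1 * v ^ (e₁ + 1)) := by
      rw [h2] at hend; simpa using hend
    have hne : b 0 + b 1 * x ^ (e₁ + 1) ≠ 0 :=
      binomial_ne_zero_of_endpoints (b 0) (b 1) (Nat.succ_ne_zero e₁) hu hx hend' hb1
    have hF : b 0 - (-(b 1)) * x ^ (e₁ + 1) ≠ 0 := by
      have : b 0 - (-(b 1)) * x ^ (e₁ + 1) = b 0 + b 1 * x ^ (e₁ + 1) := by ring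
      rwa [this]
    have hψ : 0 < rowPsi1 e₁ e₂ (b 0) (-(b 1)) 0 x := pair01_pole_rowPsi1_pos e₁ e₂ (b 0) (-(b 1)) hx0 (by nlinarith) hF
    rw [hn2]
    refine ⟨by rwa [zero_mul, sub_zero], ?_, ?_, ?_⟩
    · have h := pair01_rowPsi3_law e₁ e₂ (b 0) (-(b 1)) x
      rw [hp]; linarith [h]
    · rw [hp]; exact pair01_rowPsi2_sq e₁ e₂ (b 0) (-(b 1)) x
    · rw [sixthOrder_c0_slow p s, sixthOrder_c1_slow p s]
      exact sixthOrder_pole_slow_pos hp0 h2ps hψ.ne'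
  · -- (K12) middle-rate knee, rate s, ring off the window
    refine ⟨s, Or.inr (Or.inl rfl), fun x hx => ?_⟩
    have hx0 := huv_pos x hx
    have hBC : 0 < (-(b 1)) * (-(b 2)) := by nlinarith
    have hψ := pair12_knee_rowPsi1_neg e₁ e₂ (-(b 1)) (-(b 2)) hx0 hBC
    have hsame : b 1 + b 2 * x ^ (e₂ + 1) ≠ 0 := by
      intro h
      have : b 1 * (b 1 + b 2 * x ^ (e₂ + 1)) = 0 := by rw [h, mul_zero]
      nlinarith [mul_self_nonneg (b 1), mul_pos hsgn (pow_pos hx0 (e₂ + 1))]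
    have hF : (0 : ℝ) - (-(b 1)) * x ^ (e₁ + 1) - (-(b 2)) * x ^ (e₁ + e₂ + 2) ≠ 0 := by
      have : (0 : ℝ) - (-(b 1)) * x ^ (e₁ + 1) - (-(b 2)) * x ^ (e₁ + e₂ + 2) = x ^ (e₁ + 1) * (b 1 + b 2 * x ^ (e₂ + 1)) := by ring
      rw [this]; exact mul_ne_zero (pow_ne_zero _ hx0.ne') hsame
    rw [h0]
    refine ⟨hF, ?_, ?_, ?_⟩
    · have h := pair12_rowPsi3_law e₁ e₂ (-(b 1)) (-(b 2)) hF
      rw [hs]; linarith [h]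
    · rw [hs]; exact pair12_rowPsi2_sq e₁ e₂ (-(b 1)) (-(b 2)) hF
    · rw [sixthOrder_c0_mid p s, sixthOrder_c1_mid p s]
      have hq := hring x hx
      rw [h0] at hq
      have hψne : rowPsi1 e₁ e₂ 0 (-(b 1)) (-(b 2)) x ≠ 0 := hψ.ne
      have hψ2 : 0 < rowPsi1 e₁ e₂ 0 (-(b 1)) (-(b 2)) x ^ 2 := by positivity
      have : 6 * ((s - p) * (2 * s - p) * (2 * s + p) * (3 * s + p)) * rowPsi1 e₁ e₂ 0 (-(b 1)) (-(b 2)) x ^ 2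
            + 240 * ((3 * s + p) * (2 * s - p)) * rowPsi1 e₁ e₂ 0 (-(b 1)) (-(b 2)) x ^ 3 + 5040 * rowPsi1 e₁ e₂ 0 (-(b 1)) (-(b 2)) x ^ 4
          = rowPsi1 e₁ e₂ 0 (-(b 1)) (-(b 2)) x ^ 2 * (6 * ((s - p) * (2 * s - p) * (2 * s + p) * (3 * s + p))
            + 240 * ((3 * s + p) * (2 * s - p)) * rowPsi1 e₁ e₂ 0 (-(b 1)) (-(b 2)) x + 5040 * rowPsi1 e₁ e₂ 0 (-(b 1)) (-(b 2)) x ^ 2) := by ring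
      rw [this]
      exact mul_pos hψ2 (by rw [hp, hs]; exact hq)
  · -- (P12) pole, rate s
    refine ⟨s, Or.inr (Or.inl rfl), fun x hx => ?_⟩
    have hx0 := huv_pos x hx
    have hv : 0 < v := hu.trans (hx.1.trans hx.2)
    have hb2 : b 2 ≠ 0 := by rintro h; rw [h, mul_zero] at hsgn; exact lt_irrefl _ hsgn
    have hend' : 0 ≤ (b 1 + b 2 * u ^ (e₂ + 1)) * (b 1 + b 2 * v ^ (e₂ + 1)) := by
      rw [h0] at hend
      have hfac : (0 + b 1 * u ^ (e₁ + 1) + b 2 * u ^ (e₁ + e₂ + 2)) * (0 + b 1 * v ^ (e₁ + 1) + b 2 * v ^ (e₁ + e₂ + 2))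
          = (u ^ (e₁ + 1) * v ^ (e₁ + 1)) * ((b 1 + b 2 * u ^ (e₂ + 1)) * (b 1 + b 2 * v ^ (e₂ + 1))) := by ring
      rw [hfac] at hend
      exact (mul_nonneg_iff_of_pos_left (mul_pos (pow_pos hu _) (pow_pos hv _))).1 hend
    have hne : b 1 + b 2 * x ^ (e₂ + 1) ≠ 0 :=
      binomial_ne_zero_of_endpoints (b 1) (b 2) (Nat.succ_ne_zero _) hu hx hend' hb2
    have hF : (0 : ℝ) - (-(b 1)) * x ^ (e₁ + 1) - (-(b 2)) * x ^ (e₁ + e₂ + 2) ≠ 0 := by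
      have : (0 : ℝ) - (-(b 1)) * x ^ (e₁ + 1) - (-(b 2)) * x ^ (e₁ + e₂ + 2) = x ^ (e₁ + 1) * (b 1 + b 2 * x ^ (e₂ + 1)) := by ring
      rw [this]; exact mul_ne_zero (pow_ne_zero _ hx0.ne') hne
    have hψ : 0 < rowPsi1 e₁ e₂ 0 (-(b 1)) (-(b 2)) x := pair12_pole_rowPsi1_pos e₁ e₂ (-(b 1)) (-(b 2)) hx0 (by nlinarith) hF
    rw [h0]
    refine ⟨hF, ?_, ?_, ?_⟩
    · have h := pair12_rowPsi3_law e₁ e₂ (-(b 1)) (-(b 2)) hF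
      rw [hs]; linarith [h]
    · rw [hs]; exact pair12_rowPsi2_sq e₁ e₂ (-(b 1)) (-(b 2)) hF
    · rw [sixthOrder_c0_mid p s, sixthOrder_c1_mid p s]
      exact sixthOrder_pole_mid_pos hp0 hps hψ
  · -- (K02) fast knee, rate p + s, ring off the window
    refine ⟨p + s, Or.inr (Or.inr rfl), fun x hx => ?_⟩
    have hx0 := huv_pos x hx
    have hn1 : -(b 1) = 0 := by rw [h1, neg_zero]
    have hAC : b 0 * (-(b 2)) < 0 := by nlinarith
    have hψ := knee_rowPsi1_neg e₁ e₂ (b 0) (-(b 2)) hx0 hAC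
    have hF : b 0 - (-(b 2)) * x ^ (e₁ + e₂ + 2) ≠ 0 := by
      intro h
      have hA : b 0 = -(b 2) * x ^ (e₁ + e₂ + 2) := by linarith
      rw [hA] at hAC
      nlinarith [sq_nonneg (b 2), pow_pos hx0 (e₁ + e₂ + 2)]
    rw [hn1]
    refine ⟨by rwa [zero_mul, sub_zero], ?_, ?_, ?_⟩
    · have h := pair02_rowPsi3_law e₁ e₂ (b 0) (-(b 2)) x
      rw [hp, hs]
      have : ((e₁ : ℝ) + 1 + ((e₂ : ℝ) + 1)) = ((e₁ : ℝ) + e₂ + 2) := by ring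
      rw [this]; linarith [h]
    · rw [hp, hs]
      have : ((e₁ : ℝ) + 1 + ((e₂ : ℝ) + 1)) = ((e₁ : ℝ) + e₂ + 2) := by ring
      rw [this]; exact pair02_rowPsi2_sq e₁ e₂ (b 0) (-(b 2)) x
    · rw [sixthOrder_c0_fast p s, sixthOrder_c1_fast p s]
      have hq := hring x hx
      rw [h1] at hq
      have hψne : rowPsi1 e₁ e₂ (b 0) 0 (-(b 2)) x ≠ 0 := hψ.ne
      have hψ2 : 0 < rowPsi1 e₁ e₂ (b 0) 0 (-(b 2)) x ^ 2 := by positivity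
      have : 6 * (12 * p ^ 4 + 56 * p ^ 3 * s + 89 * p ^ 2 * s ^ 2 + 56 * p * s ^ 3 + 12 * s ^ 4) * rowPsi1 e₁ e₂ (b 0) 0 (-(b 2)) x ^ 2
            + 120 * (12 * p ^ 2 + 26 * p * s + 12 * s ^ 2) * rowPsi1 e₁ e₂ (b 0) 0 (-(b 2)) x ^ 3 + 5040 * rowPsi1 e₁ e₂ (b 0) 0 (-(b 2)) x ^ 4
          = rowPsi1 e₁ e₂ (b 0) 0 (-(b 2)) x ^ 2 * (6 * (12 * p ^ 4 + 56 * p ^ 3 * s + 89 * p ^ 2 * s ^ 2 + 56 * p * s ^ 3 + 12 * s ^ 4)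
            + 120 * (12 * p ^ 2 + 26 * p * s + 12 * s ^ 2) * rowPsi1 e₁ e₂ (b 0) 0 (-(b 2)) x + 5040 * rowPsi1 e₁ e₂ (b 0) 0 (-(b 2)) x ^ 2) := by ring
      rw [this]
      refine mul_pos hψ2 ?_
      rw [hp, hs]; rw [neg_zero] at hq; exact hq
  · -- (P02) pole, rate p + s
    refine ⟨p + s, Or.inr (Or.inr rfl), fun x hx => ?_⟩
    have hx0 := huv_pos x hx
    have hn1 : -(b 1) = 0 := by rw [h1, neg_zero]
    have hb2 : b 2 ≠ 0 := by rintro h; rw [h, mul_zero] at hsgn; exact lt_irrefl _ hsgn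
    have hend' : 0 ≤ (b 0 + b 2 * u ^ (e₁ + e₂ + 2)) * (b 0 + b 2 * v ^ (e₁ + e₂ + 2)) := by
      rw [h1] at hend; simpa using hend
    have hne : b 0 + b 2 * x ^ (e₁ + e₂ + 2) ≠ 0 :=
      binomial_ne_zero_of_endpoints (b 0) (b 2) (Nat.succ_ne_zero _) hu hx hend' hb2
    have hF : b 0 - (-(b 2)) * x ^ (e₁ + e₂ + 2) ≠ 0 := by
      have : b 0 - (-(b 2)) * x ^ (e₁ + e₂ + 2) = b 0 + b 2 * x ^ (e₁ + e₂ + 2) := by ring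
      rwa [this]
    have hψ : 0 < rowPsi1 e₁ e₂ (b 0) 0 (-(b 2)) x := pair02_pole_rowPsi1_pos e₁ e₂ (b 0) (-(b 2)) hx0 (by nlinarith) hF
    rw [hn1]
    refine ⟨by rwa [zero_mul, sub_zero], ?_, ?_, ?_⟩
    · have h := pair02_rowPsi3_law e₁ e₂ (b 0) (-(b 2)) x
      rw [hp, hs]
      have : ((e₁ : ℝ) + 1 + ((e₂ : ℝ) + 1)) = ((e₁ : ℝ) + e₂ + 2) := by ring
      rw [this]; linarith [h]
    · rw [hp, hs]
      have : ((e₁ : ℝ) + 1 + ((e₂ : ℝ) + 1)) = ((e₁ : ℝ) + e₂ + 2) := by ring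
      rw [this]; exact pair02_rowPsi2_sq e₁ e₂ (b 0) (-(b 2)) x
    · rw [sixthOrder_c0_fast p s, sixthOrder_c1_fast p s]
      exact sixthOrder_pole_fast_pos hp0 hs0 hψ

end ProductPlusOne

end Summit.ValiantsHypothesis.ValiantsHypothesis.Theorems.LacunarySymmetroidMatrixDescartes
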